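import Summits.ABC.IUTFork.Joshi.LocalPeriodRingsSection
import HarnessLib

/-!
# [J-III] Lemma 5.2.3.1: slot T-09's instance-free typing `BELinDisjoint` IS EQUIVALENT to the printed (5.2.3.2)∧(5.2.4.1)
# read as «`B ⊗_{E_0} E = (B ⊗_{ℚ_p} E)/(E_0-balancing) → B_dR` is injective» — proof-only faithfulness companion (0 defs)

Block E (rung LADDER-ABC:A2.E) of the abc-iut cell; seat abc-iut-E-t13 (gen 6). PROOF-ONLY companion of slot T-09's SIGNATURE file
`Joshi/LocalPeriodRings.lean` (p429989: `BEDatum.BELinDisjoint` = [J-III] Lemma 5.2.3.1 ∧ (5.2.4.1) «in instance-free form: `B`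
and `E` are linearly disjoint over `E_0` in `B_dR`», the cited [FF18, Prop. 1.6.9]) and of this seat's
`Joshi/LocalPeriodRingsSection.lean` (p446273: the `E_0`-balancing ideal `balanceIdeal ⊂ B̃_E = B ⊗_{ℚ_p} E`, generated by
`1 ⊗ c − φ(c) ⊗ 1`, `c ∈ E_0`, so that `B̃_E / balanceIdeal` is the standard presentation of `B ⊗_{E_0} E`; and
`mem_balanceIdeal_of_btildeToBdR_eq_zero`: `BELinDisjoint ⟹ ker m ⊆ balanceIdeal` for the multiplication map
`m : B̃_E → B_dR`). Source: K. Joshi, *Construction of Arithmetic Teichmüller Spaces III*, arXiv:2401.13508**v4** = [J-III]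
(UNREFEREED; bib `Joshi2024ATS3`; disputed by `Mochizuki2024JoshiReport`), §5.2.3–§5.2.4 p.39 l.29–49 of the cell's render
`HOME/lit/renders/Joshi-arxiv-2401.13508/p0039.txt`. DEFS-FREEZE respected; 0 `def`s, no `Prop` definition, no instance, no
notation, no axiom, 0 `sorry`. TAKES NO SIDE on [IUTchIII] Cor. 3.12, on Joshi's claims or on Mochizuki's report; typed ≠ proved ≠
endorsed — this file says the TYPED sentence and the PRINTED sentence (in the balancing presentation) are the same sentence.

## What is proved (faithfulness evidence for the referee lanes E-ref / ref-x on node J3:Lem5.2.3.1)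

Print: «(5.2.3.2) `B_E ≃ B ⊗_{E_0} E` … (5.2.4.1) `B_E = B ⊗_{E_0} E ↪ B_dR`». With `B ⊗_{E_0} E := B̃_E / balanceIdeal` and
`B_E := B·E = range m` (T-09's definition), (5.2.3.2)∧(5.2.4.1) say exactly: **the map `B̃_E/balanceIdeal → B_dR` induced by
`m` is injective, i.e. `ker m ⊆ balanceIdeal`** (the inclusion `balanceIdeal ⊆ ker m` and the surjectivity onto `B_E` being
unconditional, p446273 / p429989). HERE: `belinDisjoint_iff_ker_subset` — **`BELinDisjoint ↔ (∀ z, m z = 0 → z ∈ balanceIdeal)`**.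
`⟹` is p446273. `⟸` (`belinDisjoint_of_ker_subset`): given an `E_0`-linearly independent family `e_1,…,e_n ∈ E` and
`c_1,…,c_n ∈ B` with `∑ c_i e_i = 0` in `B_dR`, the element `z = ∑ c_i ⊗ e_i` lies in `ker m`, hence in `balanceIdeal`; an
`E_0`-linear functional `λ_i : E → E_0` dual to the family (`λ_i(e_j) = δ_ij`, from a basis extension over the FIELD `E_0`)
induces the `ℚ_p`-linear «coefficient map» `Λ_i : B̃_E → B`, `b ⊗ e ↦ φ(λ_i e)·b`, which kills `r·(1 ⊗ c − φ(c) ⊗ 1)` for every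
`r` (as `λ_i` is `E_0`-linear and `φ` multiplicative), hence kills `balanceIdeal`, and sends `z` to `c_i`; so `c_i = 0`.

bears_on: LADDER-ABC:A2.E. [claim: Joshi2024ATS3, status: disputed]
-/

noncomputable section

open scoped TensorProduct

namespace Summit.ABC.IUTFork.Joshi.ATS3

namespace PeriodRingTower

namespace BEDatum

variable {F B E0 : Type} [Field F] [CommRing B] [Field E0] {Y : Type} {K : Y → Type} [∀ y, Field (K y)]
  {G : Type} [Group G] {D : PeriodRingDatum F B E0 Y K G} {p : ℕ} [Fact p.Prime] [Algebra ℚ_[p] B]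
  {Ω : Type} [Field Ω] [Algebra ℚ_[p] Ω] {T : PeriodRingTower D p Ω} (ℰ : T.BEDatum)

/-- `E → E` as an `E_0`-submodule of `B_dR`, `ℚ_p`-linearly: `e ↦ e`. Recorded as an existence statement (0 defs): there is a
`ℚ_p`-linear map `ι : E → ESubmoduleE0` with `(ι e : Ω) = e`. [folklore] -/
theorem exists_toESubmoduleE0 : ∃ ι : ℰ.E →ₗ[ℚ_[p]] ℰ.ESubmoduleE0, ∀ e : ℰ.E, ((ι e : ℰ.ESubmoduleE0) : Ω) = (e : Ω) :=
  ⟨{ toFun := fun e => ⟨(e : Ω), e.2⟩,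
      map_add' := fun _ _ => rfl,
      map_smul' := fun c e => Subtype.ext (by
        change ((c • e : ℰ.E) : Ω) = c • (e : Ω)
        rw [IntermediateField.coe_smul]) }, fun _ => rfl⟩

/-- Over the FIELD `E_0`, an `E_0`-linearly independent finite family in `E` has DUAL `E_0`-linear functionals `E → E_0`
(`λ_i(v_j) = δ_ij`; basis extension / `LinearMap.exists_extend`). [folklore] -/
theorem exists_dual_functional {n : ℕ} (v : Fin n → ℰ.ESubmoduleE0) (hv : LinearIndependent ℰ.E0 v) (i : Fin n) :
    ∃ lam : ℰ.ESubmoduleE0 →ₗ[ℰ.E0] ℰ.E0, ∀ j, lam (v j) = if j = i then 1 else 0 := by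
  obtain ⟨g, hg⟩ := LinearMap.exists_extend ((Finsupp.lapply i).comp hv.repr)
  refine ⟨g, fun j => ?_⟩
  have hmem : v j ∈ Submodule.span ℰ.E0 (Set.range v) := Submodule.subset_span ⟨j, rfl⟩
  have h1 : g (v j) = ((Finsupp.lapply i).comp hv.repr) ⟨v j, hmem⟩ := by
    rw [← hg]; rfl
  rw [h1, LinearMap.comp_apply, hv.repr_eq_single j ⟨v j, hmem⟩ rfl, Finsupp.lapply_apply, Finsupp.single_apply]

/-- **The printed form implies the typed form**: if `ker m ⊆ balanceIdeal` — i.e. the map `B ⊗_{E_0} E = B̃_E/(E_0-balancing)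
→ B_dR` induced by `b ⊗ e ↦ b·e` is injective, which is (5.2.3.2)∧(5.2.4.1) in the balancing presentation —, then `B` and `E`
are linearly disjoint over `E_0` in `B_dR` (T-09's `BELinDisjoint`). [claim: Joshi2024ATS3, status: disputed] -/
theorem belinDisjoint_of_ker_subset (hker : ∀ z : ℰ.Btilde, ℰ.btildeToBdR z = 0 → z ∈ ℰ.balanceIdeal) :
    ℰ.BELinDisjoint := by
  intro n e he hli c hsum i
  -- the family inside the `E_0`-module `E ⊂ B_dR`, still linearly independent
  let v : Fin n → ℰ.ESubmoduleE0 := fun j => ⟨e j, he j⟩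
  have hv : LinearIndependent ℰ.E0 v := LinearIndependent.of_comp ℰ.ESubmoduleE0.subtype hli
  obtain ⟨lam, hlam⟩ := ℰ.exists_dual_functional v hv i
  obtain ⟨ι, hι⟩ := ℰ.exists_toESubmoduleE0
  -- the `ℚ_p`-linear coefficient functional `μ = λ_i ∘ ι : E → E_0` and the coefficient map `Λ : B̃_E → B`, `b ⊗ f ↦ φ(μ f)·b`
  let μ : ℰ.E →ₗ[ℚ_[p]] ℰ.E0 := (lam.restrictScalars ℚ_[p]).comp ι
  have hμ_mul : ∀ (f : ℰ.E) (c' : ℰ.E0), μ (f * ℰ.e0ToE c') = c' * μ f := by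
    intro f c'
    have hι' : ι (f * ℰ.e0ToE c') = c' • ι f := by
      apply Subtype.ext
      rw [hι, Submodule.coe_smul, hι, Algebra.smul_def, mul_comm]
      rfl
    change lam (ι (f * ℰ.e0ToE c')) = c' * lam (ι f)
    rw [hι', map_smul, smul_eq_mul]
  let Λ : ℰ.Btilde →ₗ[ℚ_[p]] B :=
    TensorProduct.lift (LinearMap.mk₂ ℚ_[p] (fun b f => ℰ.e0ToB (μ f) * b)
      (fun b₁ b₂ f => by rw [mul_add])
      (fun a b f => by rw [mul_smul_comm])
      (fun b f₁ f₂ => by rw [map_add, map_add, add_mul])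
      (fun a b f => by rw [map_smul, map_smul, smul_mul_assoc]))
  have hΛ : ∀ (b : B) (f : ℰ.E), Λ (b ⊗ₜ[ℚ_[p]] f) = ℰ.e0ToB (μ f) * b := fun b f => by
    simp only [Λ, TensorProduct.lift.tmul, LinearMap.mk₂_apply]
  -- `Λ` kills every multiple of a balancing generator …
  have hgen : ∀ (c' : ℰ.E0) (r : ℰ.Btilde),
      Λ (r * ((1 : B) ⊗ₜ[ℚ_[p]] ℰ.e0ToE c' - ℰ.e0ToB c' ⊗ₜ[ℚ_[p]] (1 : ℰ.E))) = 0 := by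
    intro c' r
    induction r using TensorProduct.induction_on with
    | zero => rw [zero_mul, map_zero]
    | tmul b f =>
        rw [mul_sub, Algebra.TensorProduct.tmul_mul_tmul, Algebra.TensorProduct.tmul_mul_tmul, mul_one, mul_one, map_sub,
          hΛ, hΛ, hμ_mul, map_mul]
        ring
    | add x y hx hy => rw [add_mul, map_add, hx, hy, add_zero]
  -- … hence kills the balancing ideal (span induction with the multiplicatively saturated predicate)
  have hideal : ∀ z ∈ ℰ.balanceIdeal, ∀ r : ℰ.Btilde, Λ (r * z) = 0 := by
    intro z hz
    induction hz using Submodule.span_induction with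
    | mem x hx => obtain ⟨c', rfl⟩ := hx; exact fun r => hgen c' r
    | zero => intro r; rw [mul_zero, map_zero]
    | add x y _ _ hx hy => intro r; rw [mul_add, map_add, hx, hy, add_zero]
    | smul a x _ hx => intro r; rw [smul_eq_mul, ← mul_assoc]; exact hx (r * a)
  -- the element `z = ∑ c_j ⊗ e_j` lies in `ker m`, hence in the balancing ideal
  set z : ℰ.Btilde := ∑ j, c j ⊗ₜ[ℚ_[p]] (⟨e j, he j⟩ : ℰ.E) with hzdef
  have hmz : ℰ.btildeToBdR z = 0 := by
    rw [hzdef, map_sum, ← hsum]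
    refine Finset.sum_congr rfl fun j _ => ?_
    rw [BEDatum.btildeToBdR, Algebra.TensorProduct.productMap_apply_tmul]
    rfl
  have hz : z ∈ ℰ.balanceIdeal := hker z hmz
  -- `Λ z = c_i` and `Λ z = 0`
  have hΛz : Λ z = c i := by
    rw [hzdef, map_sum]
    have hterm : ∀ j, Λ (c j ⊗ₜ[ℚ_[p]] (⟨e j, he j⟩ : ℰ.E)) = if j = i then c i else 0 := by
      intro j
      rw [hΛ]
      have hμj : μ ⟨e j, he j⟩ = lam (v j) := by
        change lam (ι ⟨e j, he j⟩) = lam (v j)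
        congr 1
        exact Subtype.ext (hι _)
      rw [hμj, hlam j]
      split_ifs with hji
      · subst hji; rw [map_one, one_mul]
      · rw [map_zero, zero_mul]
    rw [Finset.sum_congr rfl fun j _ => hterm j, Finset.sum_ite_eq' Finset.univ i (fun _ => c i)]
    simp
  have hΛz0 : Λ z = 0 := by
    have h := hideal z hz 1
    rwa [one_mul] at h
  rw [← hΛz, hΛz0]

/-- **[J-III] Lemma 5.2.3.1: TYPED FORM ⟺ PRINTED FORM.** Slot T-09's instance-free `BELinDisjoint` («`B` and `E` linearly
disjoint over `E_0` in `B_dR`») holds iff `ker m ⊆ (E_0-balancing ideal)`, i.e. iff the multiplication map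
`B ⊗_{E_0} E = (B ⊗_{ℚ_p} E)/(E_0-balancing) → B_dR` is injective — (5.2.3.2) «`B_E ≃ B ⊗_{E_0} E`» ∧ (5.2.4.1)
«`B ⊗_{E_0} E ↪ B_dR`» with `B_E := B·E` (T-09) and `B ⊗_{E_0} E` in the balancing presentation (p446273). `⟹` is p446273's
`mem_balanceIdeal_of_btildeToBdR_eq_zero`. [claim: Joshi2024ATS3, status: disputed] -/
theorem belinDisjoint_iff_ker_subset :
    ℰ.BELinDisjoint ↔ ∀ z : ℰ.Btilde, ℰ.btildeToBdR z = 0 → z ∈ ℰ.balanceIdeal :=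
  ⟨fun h _ hz => ℰ.mem_balanceIdeal_of_btildeToBdR_eq_zero h hz, ℰ.belinDisjoint_of_ker_subset⟩

/-- The same with the kernel as an ideal: `BELinDisjoint ↔ ker m = balanceIdeal` (the inclusion `⊇` is unconditional,
p446273 `btildeToBdR_eq_zero_of_mem`). [claim: Joshi2024ATS3, status: disputed] -/
theorem belinDisjoint_iff_ker_eq : ℰ.BELinDisjoint ↔ RingHom.ker ℰ.btildeToBdR = ℰ.balanceIdeal := by
  rw [belinDisjoint_iff_ker_subset]
  constructor
  · intro h
    ext z
    rw [RingHom.mem_ker]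
    exact ⟨h z, ℰ.btildeToBdR_eq_zero_of_mem⟩
  · intro h z hz
    rw [← h, RingHom.mem_ker]
    exact hz

end BEDatum

end PeriodRingTower

end Summit.ABC.IUTFork.Joshi.ATS3

end
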